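import Summits.ValiantsHypothesis.ValiantsHypothesis.Theorems.SymPencilPerFourBasePointPackage
import Summits.ValiantsHypothesis.ValiantsHypothesis.Theorems.SymPencilBasePointMoments

/-!
# Route `SymPencil` — the base-point moments for a GENERAL kernel direction: the square family is
# the `D_v⁻¹`-norm of the kernel rows (tool/interface file, `--supports`
# stmt-ValiantsHypothesis-5674; rung currency for `sdc(per_4)`, nothing here bears on `VP ≠ VNP`)

Let `(D, bL, CL, κ)` be the base-point package of a symmetric affine determinantal representation
of `per_4` (`SymPencilPerFourBasePointPackage`): for every `v ∈ ker bL` the matrix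
`D_v := D + CL v` is invertible and `κ per_4 (v + s z) = det [[0, s bᵀ], [s b, D_v + s CL z]]`
(`b = bL z`).  Since `ker bL ⊆ Sing Z(per_4)`, for `v ∈ ker bL` and any `z` one has
`per_4 (z + s v) = e₀ + s e₁ + s² S` (no `s³, s⁴`), equivalently (homogeneity)
`per_4 (v + s z) = s² S + s³ e₁ + s⁴ e₀`; here `S = S(z, v)` is the value of the joint square family
`Σ_k c_k β_k(z, v)²` of the origin package (`SymPencilIsotropicKernelSquaresBilinear`).

**Theorem** (`basepoint_family`).  For every `v ∈ ker bL`, every `z`, and every such expansion,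

  (i_v)   `det D_v · bᵀ D_v⁻¹ b = -κ S(z, v)`,
  (ii_v)  `det D_v · (d₁ bᵀ D_v⁻¹ b - bᵀ D_v⁻¹ C(z) D_v⁻¹ b) = -κ e₁(z, v)`   (some scalar `d₁`),
  (iii_v) `det D_v · (d₂ bᵀD_v⁻¹b - d₁ bᵀD_v⁻¹CD_v⁻¹b + bᵀD_v⁻¹CD_v⁻¹CD_v⁻¹b) = -κ e₀`  (some `d₂`),

from the abstract coefficient lemma `moments_two` (the twin of `SymPencilOriginMoments.moments_four`
two orders lower).  At `v = 0` these are the origin moments; for a one-row kernel `S ≡ 0` and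
(i_v) is the isotropy used in `SymPencilPerFourOneRowKernel`.  For the OTHER cells of the
kernel-package table (`dim V ≥ 5`) identity (i_v) is a new lever: as a function of `v ∈ V` the
left side is `b(z)ᵀ adj(D + C(v)) b(z)`, a polynomial of degree `≤ |ι'| - 1`, while the right side
is the QUADRATIC square family — so all `v`-homogeneous components of `bᵀ adj(D + C(v)) b` of
degree `≥ 3` vanish on `V`, and the degree-`2` component is `-κ Σ_k c_k β_k(z,v)²`.  Recorded
here as an interface for the size-`27` table; no cell is closed in this file. [folklore]
-/

noncomputable section

-- single-conjunct layout: Sub = Summit, duplicated namespace component intended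
set_option linter.dupNamespace false

namespace Summit.ValiantsHypothesis.ValiantsHypothesis.Theorems.SymPencilBasePointFamily

open Matrix Polynomial MvPolynomial
open Literature.Computability.AlgebraicComplexity
open Summit.ValiantsHypothesis.ValiantsHypothesis.Theorems.SymPencilHomogeneousDropTools
open Summit.ValiantsHypothesis.ValiantsHypothesis.Theorems.SymPencilAdjugateExpansion
open Summit.ValiantsHypothesis.ValiantsHypothesis.Theorems.SymPencilOriginMoments
open Summit.ValiantsHypothesis.ValiantsHypothesis.Theorems.SymPencilHomogeneousHessianRank

universe u

variable {k : Type u} [Field k] [CharZero k] {ι' : Type*} [Fintype ι'] [DecidableEq ι']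

/-- **The bordered-pencil coefficients at quadratic order.**  If
`det [[s a₀, s b₀ᵀ], [s b₀, N + s C₀]] = s² φ₂ + s³ φ₃ + s⁴ φ₄` for all `s`, with `N` invertible,
then `a₀ = 0`, `det N · b₀ᵀN⁻¹b₀ = -φ₂`, and with the first two coefficients `d₁, d₂` of
`det (1 + X N⁻¹C₀)`: `det N · (d₁ b₀ᵀN⁻¹b₀ - b₀ᵀN⁻¹C₀N⁻¹b₀) = -φ₃` and
`det N · (d₂ b₀ᵀN⁻¹b₀ - d₁ b₀ᵀN⁻¹C₀N⁻¹b₀ + b₀ᵀN⁻¹C₀N⁻¹C₀N⁻¹b₀) = -φ₄`. [folklore] -/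
theorem moments_two {N C₀ : Matrix ι' ι' k} (hN : IsUnit N.det) (a₀ φ₂ φ₃ φ₄ : k) (b₀ : ι' → k)
    (hE : ∀ s : k, (Matrix.fromBlocks ((s * a₀) • (1 : Matrix Unit Unit k))
        (Matrix.replicateRow Unit (s • b₀)) (Matrix.replicateCol Unit (s • b₀)) (N + s • C₀)).det =
        s ^ 2 * φ₂ + s ^ 3 * φ₃ + s ^ 4 * φ₄) :
    a₀ = 0 ∧ N.det * (b₀ ⬝ᵥ N⁻¹ *ᵥ b₀) = -φ₂ ∧ ∃ d₁ d₂ : k,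
      N.det * (d₁ * (b₀ ⬝ᵥ N⁻¹ *ᵥ b₀) - b₀ ⬝ᵥ (N⁻¹ * C₀ * N⁻¹) *ᵥ b₀) = -φ₃ ∧
      N.det * (d₂ * (b₀ ⬝ᵥ N⁻¹ *ᵥ b₀) - d₁ * (b₀ ⬝ᵥ (N⁻¹ * C₀ * N⁻¹) *ᵥ b₀) +
        b₀ ⬝ᵥ (N⁻¹ * C₀ * N⁻¹ * C₀ * N⁻¹) *ᵥ b₀) = -φ₄ := by
  classical
  have hN0 : N.det ≠ 0 := hN.ne_zero
  set δ : k[X] := (N.map Polynomial.C + (Polynomial.X : k[X]) • C₀.map Polynomial.C).det with hδ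
  set g : k[X] := (fun i => Polynomial.C (b₀ i)) ⬝ᵥ
      adjugate (N.map Polynomial.C + (Polynomial.X : k[X]) • C₀.map Polynomial.C) *ᵥ
      (fun i => Polynomial.C (b₀ i)) with hg
  set Q : k[X] := Polynomial.C a₀ * (Polynomial.X ^ 1 * δ) - Polynomial.X ^ 2 * g -
      Polynomial.C φ₂ * Polynomial.X ^ 2 - Polynomial.C φ₃ * Polynomial.X ^ 3 -
      Polynomial.C φ₄ * Polynomial.X ^ 4 with hQ
  have hroot : ∀ s : k, (N + s • C₀).det ≠ 0 → Q.IsRoot s := by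
    intro s hs
    have hSu : IsUnit (N + s • C₀).det := isUnit_iff_ne_zero.2 hs
    have h1 := hE s
    rw [det_fromBlocks_border hSu, Matrix.mulVec_smul, dotProduct_smul, smul_dotProduct,
      smul_eq_mul, smul_eq_mul] at h1
    have hadj : b₀ ⬝ᵥ adjugate (N + s • C₀) *ᵥ b₀ =
        (N + s • C₀).det * (b₀ ⬝ᵥ (N + s • C₀)⁻¹ *ᵥ b₀) := by
      have : adjugate (N + s • C₀) = (N + s • C₀).det • (N + s • C₀)⁻¹ := by
        rw [Matrix.nonsing_inv_apply _ hSu, smul_smul, IsUnit.mul_val_inv, one_smul]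
      rw [this, Matrix.smul_mulVec, dotProduct_smul, smul_eq_mul]
    rw [Polynomial.IsRoot.def, hQ]
    simp only [Polynomial.eval_sub, Polynomial.eval_mul, Polynomial.eval_C, Polynomial.eval_X,
      Polynomial.eval_pow]
    rw [hδ, eval_detLine, hg, eval_bilin_adjugate_line, hadj]
    linear_combination h1
  have hQ0 : Q = 0 := by
    apply Polynomial.eq_zero_of_infinite_isRoot
    have hδ0 : δ ≠ 0 := by
      intro h
      have h0 := coeff_detLine_zero N C₀
      rw [← hδ, h, Polynomial.coeff_zero] at h0
      exact hN0 h0.symm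
    have hfin : Set.Finite {s : k | δ.IsRoot s} := (δ.roots.toFinset.finite_toSet).subset
      fun s hs => by
        simp only [Set.mem_setOf_eq] at hs
        simp only [Finset.mem_coe, Multiset.mem_toFinset, Polynomial.mem_roots hδ0]
        exact hs
    refine (hfin.infinite_compl).mono fun s hs => ?_
    simp only [Set.mem_compl_iff, Set.mem_setOf_eq, Polynomial.IsRoot.def, hδ, eval_detLine] at hs
    exact hroot s hs
  obtain ⟨d₁, d₂, hg0, hg1, hg2⟩ := coeff_bilin_adjugate_line hN C₀ b₀ b₀
  rw [← hg] at hg0 hg1 hg2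
  have hδc0 : δ.coeff 0 = N.det := by rw [hδ, coeff_detLine_zero]
  have hc : ∀ n, Q.coeff n = 0 := fun n => by rw [hQ0, Polynomial.coeff_zero]
  have hQn : ∀ n, Q.coeff n = a₀ * (if 1 ≤ n then δ.coeff (n - 1) else 0) -
      (if 2 ≤ n then g.coeff (n - 2) else 0) - (if n = 2 then φ₂ else 0) -
      (if n = 3 then φ₃ else 0) - (if n = 4 then φ₄ else 0) := by
    intro n
    rw [hQ, Polynomial.coeff_sub, Polynomial.coeff_sub, Polynomial.coeff_sub,
      Polynomial.coeff_sub, Polynomial.coeff_C_mul, Polynomial.coeff_X_pow_mul',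
      Polynomial.coeff_X_pow_mul', Polynomial.coeff_C_mul_X_pow, Polynomial.coeff_C_mul_X_pow,
      Polynomial.coeff_C_mul_X_pow]
  have e1 := hQn 1
  have e2 := hQn 2
  have e3 := hQn 3
  have e4 := hQn 4
  norm_num at e1 e2 e3 e4
  rw [hc] at e1 e2 e3 e4
  rw [hδc0] at e1
  have h1 : a₀ = 0 := by
    rcases mul_eq_zero.1 e1.symm with h | h
    · exact h
    · exact absurd h hN0
  rw [h1, zero_mul, zero_sub] at e2 e3 e4
  rw [hg0] at e2
  rw [hg1] at e3
  rw [hg2] at e4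
  refine ⟨h1, by linear_combination e2, d₁, d₂, by linear_combination e3,
    by linear_combination e4⟩

/-- **The base-point family identity.**  In the base-point package of a symmetric affine
determinantal representation of `per_4` (any data satisfying the base-point pencil identity), for
`v ∈ ker bL`, any `z`, and any expansion `per_4 (z + s v) = e₀ + s e₁ + s² S` one has
`det (D + CL v) · bL(z)ᵀ (D + CL v)⁻¹ bL(z) = -κ S` together with the cubic and quartic companions.
See the module docstring. [folklore] -/
theorem basepoint_family {D : Matrix ι' ι' k} (bL : (Fin 4 × Fin 4 → k) →ₗ[k] (ι' → k))
    (CL : (Fin 4 × Fin 4 → k) →ₗ[k] Matrix ι' ι' k) {κ : k}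
    (hN : ∀ v, bL v = 0 → IsUnit (D + CL v).det ∧ ∀ (z : Fin 4 × Fin 4 → k) (s : k),
      κ * MvPolynomial.eval (v + s • z) (perPoly (Fin 4) k) =
        (Matrix.fromBlocks ((s * 0) • (1 : Matrix Unit Unit k))
          (Matrix.replicateRow Unit (s • bL z)) (Matrix.replicateCol Unit (s • bL z))
          (D + CL v + s • CL z)).det)
(hκ : κ ≠ 0) (v : Fin 4 × Fin 4 → k) (hv : bL v = 0) (z : Fin 4 × Fin 4 → k) (e₀ e₁ S : k)
    (hexp : ∀ s : k, MvPolynomial.eval (z + s • v) (perPoly (Fin 4) k) = e₀ + s * e₁ + s ^ 2 * S) :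
    (D + CL v).det * (bL z ⬝ᵥ (D + CL v)⁻¹ *ᵥ bL z) = -(κ * S) ∧ ∃ d₁ d₂ : k,
      (D + CL v).det * (d₁ * (bL z ⬝ᵥ (D + CL v)⁻¹ *ᵥ bL z) -
        bL z ⬝ᵥ ((D + CL v)⁻¹ * CL z * (D + CL v)⁻¹) *ᵥ bL z) = -(κ * e₁) ∧
      (D + CL v).det * (d₂ * (bL z ⬝ᵥ (D + CL v)⁻¹ *ᵥ bL z) -
        d₁ * (bL z ⬝ᵥ ((D + CL v)⁻¹ * CL z * (D + CL v)⁻¹) *ᵥ bL z) +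
        bL z ⬝ᵥ ((D + CL v)⁻¹ * CL z * (D + CL v)⁻¹ * CL z * (D + CL v)⁻¹) *ᵥ bL z) =
        -(κ * e₀) := by
  obtain ⟨hNv, hdet⟩ := hN v hv
  have hhom : (perPoly (Fin 4) k).IsHomogeneous 4 := by
    simpa using (perPoly_isHomogeneous (n := Fin 4) (k := k))
  -- `per_4 (v + s z) = s² S + s³ e₁ + s⁴ e₀`
  have hexp' : ∀ s : k, MvPolynomial.eval (v + s • z) (perPoly (Fin 4) k) =
      s ^ 2 * S + s ^ 3 * e₁ + s ^ 4 * e₀ := by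
    intro s
    by_cases hs : s = 0
    · subst hs
      -- `per_4 (v) = 0` from the pencil identity at `s = 0`
      have h := hdet z 0
      have hrow : Matrix.replicateRow Unit ((0 : k) • bL z) = 0 := by
        ext i j; simp
      have hcol : Matrix.replicateCol Unit ((0 : k) • bL z) = 0 := by
        ext i j; simp
      rw [hrow, hcol, zero_mul, zero_smul, zero_smul, add_zero, Matrix.det_fromBlocks_zero₁₂,
        Matrix.det_zero, zero_mul] at h
      have hv0 : MvPolynomial.eval v (perPoly (Fin 4) k) = 0 :=
        (mul_eq_zero.1 h).resolve_left hκ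
      simp [hv0]
    · have hs4 : s ^ 4 ≠ 0 := pow_ne_zero 4 hs
      have h1 : v + s • z = s • (z + s⁻¹ • v) := by
        rw [smul_add, smul_smul, mul_inv_cancel₀ hs, one_smul, add_comm]
      rw [h1, eval_smul_of_isHomogeneous hhom, hexp s⁻¹]
      field_simp
      ring
  have hE : ∀ s : k, (Matrix.fromBlocks ((s * 0) • (1 : Matrix Unit Unit k))
      (Matrix.replicateRow Unit (s • bL z)) (Matrix.replicateCol Unit (s • bL z))
      (D + CL v + s • CL z)).det = s ^ 2 * (κ * S) + s ^ 3 * (κ * e₁) + s ^ 4 * (κ * e₀) := by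
    intro s
    rw [← hdet z s, hexp' s]
    ring
  obtain ⟨-, h2, d₁, d₂, h3, h4⟩ := moments_two hNv 0 (κ * S) (κ * e₁) (κ * e₀) (bL z) hE
  exact ⟨h2, d₁, d₂, h3, h4⟩

end Summit.ValiantsHypothesis.ValiantsHypothesis.Theorems.SymPencilBasePointFamily

end
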